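import Literature.Analysis.ODE.GalerkinLimit
import HarnessLib

/-!
# Coordinate (Galerkin) projections on `ℓᵖ` sequence spaces

Topic `Literature/Analysis/ODE`.  The sequence spaces `ℓᵖ`, `1 ≤ p < ∞`, are GOOD SEQUENCE SPACES
in the sense of [WilczakZgliczynski2025, §2 Def. 1] ("Examples: `l_2`, `l_1`, …"): the coordinate
projections `P_J` satisfy `‖P_J w‖ ≤ ‖w‖` (axiom 4), `|w_i| ≤ ‖w‖` (axiom 5 with `G = 1`) and
`w = Σ_i w_i e_i`, i.e. `‖(I - P_n) w‖ → 0` (axiom 2 / Lemma 1, eq. (remto0)) — whereas `ℓ^∞`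
is not (axiom 2 fails).  This file records these facts for Mathlib's `lp E p` (fibres `E i` any
real normed spaces — for a Fourier–Galerkin scheme `E i = ℝ` or `ℝ²`) and discharges with them
the STRUCTURAL hypotheses (`‖P_n‖ ≤ C`, `P_n w → w`, `P_n P_k = P_n`) of the abstract
`C⁰`-convergence theorem `Literature.Analysis.ODE.GalerkinConvergenceSetting.exists_limit`
([WilczakZgliczynski2025, §4 Thm. 11]; file `GalerkinLimit.lean`), so that on `ℓᵖ(ℕ; E)` a
`GalerkinConvergenceSetting` is obtained from the problem-specific data alone.

## Main statements

* `lpEval E p i : lp E p →L[ℝ] E i` (evaluation, norm `≤ 1`), `lpProj E p s : lp E p →L[ℝ] lp E p`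
  (projection onto the modes in a finite set `s`), `lpProj_coe_apply`
  (`(P_s f) j = if j ∈ s then f j else 0`), `lpProj_lpProj` (`P_s P_t = P_{s ∩ t}`),
  `lpProj_lpProj_of_subset`, `lpProj_idem`, `norm_lpProj_le` (`‖P_s f‖ ≤ ‖f‖`, every `p ≥ 1`
  including `∞`), `opNorm_lpProj_le` (`‖P_s‖ ≤ 1`), `tendsto_lpProj_atTop` (`P_s f → f` along
  the finite sets, `p < ∞`).
* `lpGalerkin E p n = P_{{0,…,n-1}}` on `ℓᵖ(ℕ; E)`: `lpGalerkin_coe_apply`, `lpGalerkin_comp`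
  (`P_n P_k = P_n`, `n ≤ k`), `opNorm_lpGalerkin_le`, `tendsto_lpGalerkin` (`p < ∞`),
  `mapsTo_lpGalerkin_coordBox` (condition S1 for coordinate boxes whose tail factors contain `0`).
* `GalerkinConvergenceSetting.of_lp`: for `1 ≤ p < ∞` and non-decreasing Galerkin dimensions
  `d n → ∞`, the setting of `GalerkinLimit.lean` for `P n = lpGalerkin E p (d n)` follows from
  S (compact `W`, `P_{d n} W ⊆ W`, `Z ⊆ W`), C1, C2 (uniform one-sided Lipschitz bound) and the
  Galerkin solutions' a priori bounds; `GalerkinConvergenceSetting.exists_limit_lp`: conclusions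
  (1)–(3) of [WilczakZgliczynski2025, Thm. 11] on `ℓᵖ(ℕ; E)` with complete fibres.

## References

* [WilczakZgliczynski2025] D. Wilczak, P. Zgliczyński, *Self-consistent bounds method for
  dissipative PDEs*, arXiv:2502.09760: §2 Def. 1 (axioms 2, 4, 5), Examples, Lemma 1; §4
  (Galerkin projections and filtration, Def. 4 (S1)), Thm. 11.
* Mathlib: `lp`, `lp.single`, `lp.hasSum_single`, `lp.norm_mono`, `lp.norm_apply_le_norm`.
-/

open Set Filter Topology Metric Finset
open scoped NNReal ENNReal

namespace Literature.Analysis.ODE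

noncomputable section

variable {α : Type*} {E : α → Type*} [∀ i, NormedAddCommGroup (E i)] [∀ i, NormedSpace ℝ (E i)]
  {p : ℝ≥0∞} [Fact (1 ≤ p)]

/-- `1 ≤ p` gives `p ≠ 0`. [folklore] -/
private theorem p_ne_zero : p ≠ 0 := (zero_lt_one.trans_le (Fact.out : 1 ≤ p)).ne'

variable (E p) in
/-- Evaluation at a coordinate, as a continuous linear map of norm `≤ 1` (axiom 5 of a good
sequence space with `G = 1`). [cite: WilczakZgliczynski2025, §2 Def. 1 (5)] -/
def lpEval (i : α) : lp E p →L[ℝ] E i :=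
  LinearMap.mkContinuous
    { toFun := fun f => f i
      map_add' := fun _ _ => rfl
      map_smul' := fun _ _ => rfl } 1
    fun f => by rw [one_mul]; exact lp.norm_apply_le_norm p_ne_zero f i

/-- `lpEval E p i f = f i`. [cite: WilczakZgliczynski2025, §2 Def. 1 (5)] -/
@[simp] theorem lpEval_apply (i : α) (f : lp E p) : lpEval E p i f = f i := rfl

variable [DecidableEq α]

variable (E p) in
/-- The coordinate (Galerkin) projection `P_s` onto the modes in a finite set `s`:
`(P_s f) i = f i` for `i ∈ s`, `0` otherwise. [cite: WilczakZgliczynski2025, §2 (projection P_J) and §4 (Galerkin projections)] -/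
def lpProj (s : Finset α) : lp E p →L[ℝ] lp E p :=
  ∑ i ∈ s, (lp.singleContinuousLinearMap ℝ E p i).comp (lpEval E p i)

/-- `P_s f = Σ_{i ∈ s} f i e_i`. [cite: WilczakZgliczynski2025, §2 Def. 1 (2) (w = Σ w_i e_i), projection P_J] -/
theorem lpProj_apply (s : Finset α) (f : lp E p) :
    lpProj E p s f = ∑ i ∈ s, lp.single p i (f i) := by
  simp [lpProj]

/-- Coordinates of the projection. [cite: WilczakZgliczynski2025, §2 (projection P_J)] -/
theorem lpProj_coe_apply (s : Finset α) (f : lp E p) (j : α) :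
    (lpProj E p s f : ∀ i, E i) j = if j ∈ s then f j else 0 := by
  rw [lpProj_apply, lp.coeFn_sum, Finset.sum_apply]
  simp [Finset.sum_pi_single]

/-- `P_s P_t = P_{s ∩ t}`. [cite: WilczakZgliczynski2025, §4 (Galerkin filtration)] -/
theorem lpProj_lpProj (s t : Finset α) (f : lp E p) :
    lpProj E p s (lpProj E p t f) = lpProj E p (s ∩ t) f := by
  refine lp.ext (funext fun j => ?_)
  simp only [lpProj_coe_apply, Finset.mem_inter]
  by_cases hs : j ∈ s <;> by_cases ht : j ∈ t <;> simp [hs, ht]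

/-- Nested projections: `s ⊆ t → P_s P_t = P_s`. [cite: WilczakZgliczynski2025, §4 (Galerkin filtration)] -/
theorem lpProj_lpProj_of_subset {s t : Finset α} (hst : s ⊆ t) (f : lp E p) :
    lpProj E p s (lpProj E p t f) = lpProj E p s f := by
  rw [lpProj_lpProj, Finset.inter_eq_left.2 hst]

/-- `P_s` is idempotent. [cite: WilczakZgliczynski2025, §2 (projection P_J)] -/
theorem lpProj_idem (s : Finset α) (f : lp E p) :
    lpProj E p s (lpProj E p s f) = lpProj E p s f :=
  lpProj_lpProj_of_subset subset_rfl f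

/-- Axiom 4 of a good sequence space: `‖P_s f‖ ≤ ‖f‖`. [cite: WilczakZgliczynski2025, §2 Def. 1 (4), Examples (l_2, l_1)] -/
theorem norm_lpProj_le (s : Finset α) (f : lp E p) : ‖lpProj E p s f‖ ≤ ‖f‖ := by
  refine lp.norm_mono p_ne_zero fun i => ?_
  rw [lpProj_coe_apply]
  split_ifs
  · exact le_rfl
  · rw [norm_zero]; exact norm_nonneg _

/-- `‖P_s‖ ≤ 1`. [cite: WilczakZgliczynski2025, §2 Def. 1 (4), Lemma 1] -/
theorem opNorm_lpProj_le (s : Finset α) : ‖lpProj E p s‖ ≤ 1 :=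
  ContinuousLinearMap.opNorm_le_bound _ zero_le_one fun f => by
    rw [one_mul]; exact norm_lpProj_le s f

/-- A vector in the range of `P_s` is fixed by `P_s`. [cite: WilczakZgliczynski2025, §2 (projection P_J)] -/
theorem lpProj_eq_self_of_mem_range {s : Finset α} {f : lp E p}
    (hf : f ∈ Set.range (lpProj E p s)) : lpProj E p s f = f := by
  obtain ⟨g, rfl⟩ := hf
  exact lpProj_idem s g

/-- Axiom 2 / Lemma 1 of a good sequence space for `ℓᵖ`, `1 ≤ p < ∞`: `P_s f → f` along the
finite sets `s`. [cite: WilczakZgliczynski2025, §2 Def. 1 (2), Lemma 1 (‖(I - P_n) w‖ → 0), Examples] -/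
theorem tendsto_lpProj_atTop (hp : p ≠ ∞) (f : lp E p) :
    Tendsto (fun s : Finset α => lpProj E p s f) atTop (𝓝 f) := by
  have h := lp.hasSum_single hp f
  simp only [HasSum, ← lpProj_apply] at h
  exact h

end

/-! ## The Galerkin filtration `P_n = P_{{0, …, n-1}}` on `ℓᵖ(ℕ; E)` -/

noncomputable section

variable {E : ℕ → Type*} [∀ i, NormedAddCommGroup (E i)] [∀ i, NormedSpace ℝ (E i)]
  {p : ℝ≥0∞} [Fact (1 ≤ p)]

variable (E p) in
/-- The Galerkin projection onto the first `n` modes of `ℓᵖ(ℕ; E)`. [cite: WilczakZgliczynski2025, §4 (Galerkin projections P_n)] -/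
def lpGalerkin (n : ℕ) : lp E p →L[ℝ] lp E p := lpProj E p (Finset.range n)

/-- Coordinates: `(P_n f) j = f j` for `j < n`, else `0`. [cite: WilczakZgliczynski2025, §4] -/
theorem lpGalerkin_coe_apply (n : ℕ) (f : lp E p) (j : ℕ) :
    (lpGalerkin E p n f : ∀ i, E i) j = if j < n then f j else 0 := by
  simp [lpGalerkin, lpProj_coe_apply]

/-- Nestedness `P_n P_k = P_n` for `n ≤ k`. [cite: WilczakZgliczynski2025, §4 (Galerkin filtration)] -/
theorem lpGalerkin_comp {n k : ℕ} (hnk : n ≤ k) (f : lp E p) :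
    lpGalerkin E p n (lpGalerkin E p k f) = lpGalerkin E p n f :=
  lpProj_lpProj_of_subset (Finset.range_subset_range.2 hnk) f

/-- `‖P_n‖ ≤ 1`. [cite: WilczakZgliczynski2025, §2 Def. 1 (4)] -/
theorem opNorm_lpGalerkin_le (n : ℕ) : ‖lpGalerkin E p n‖ ≤ 1 := opNorm_lpProj_le _

/-- `P_n f → f` for `1 ≤ p < ∞` (for `p = ∞` this FAILS: `ℓ^∞` is not a good sequence space).
[cite: WilczakZgliczynski2025, §2 Lemma 1 (eq. remto0), Examples] -/
theorem tendsto_lpGalerkin (hp : p ≠ ∞) (f : lp E p) :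
    Tendsto (fun n => lpGalerkin E p n f) atTop (𝓝 f) := by
  have h := (lp.hasSum_single hp f).tendsto_sum_nat
  simp only [← lpProj_apply] at h
  exact h

/-- Condition S1 for coordinate boxes: if `W = {f | ∀ i, f i ∈ B i}` and `0 ∈ B i` for every
mode `i ≥ n`, then `P_n W ⊆ W` (self-consistent bounds are such boxes, with tails centred at `0`).
[cite: WilczakZgliczynski2025, §4 Def. 4 (S1)] -/
theorem mapsTo_lpGalerkin_coordBox {B : ∀ i, Set (E i)} {n : ℕ}
    (hB : ∀ i, n ≤ i → (0 : E i) ∈ B i) :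
    MapsTo (lpGalerkin E p n) {f : lp E p | ∀ i, f i ∈ B i} {f : lp E p | ∀ i, f i ∈ B i} := by
  intro f hf i
  simp only [Set.mem_setOf_eq] at hf ⊢
  rw [lpGalerkin_coe_apply]
  split_ifs with h
  · exact hf i
  · exact hB i (not_lt.1 h)

/-- The structural (projection) hypotheses of `GalerkinConvergenceSetting` hold for any Galerkin
filtration `P_{d n}` of `ℓᵖ(ℕ; E)`, `1 ≤ p < ∞`, along non-decreasing dimensions `d n → ∞`
(e.g. `d n = M + n`, re-indexing [WilczakZgliczynski2025]'s "for `n ≥ M`"): a setting is obtained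
from the problem-specific data alone (S: `W` compact with `P_{d n} W ⊆ W`, `Z ⊆ W`; C1; C2 as a
uniform one-sided Lipschitz bound; the Galerkin solutions with their a priori bounds).
[cite: WilczakZgliczynski2025, §2 Def. 1, Lemma 1; §4 Def. 4–6, Thm. 11] -/
theorem GalerkinConvergenceSetting.of_lp (hp : p ≠ ∞) {d : ℕ → ℕ} (hd : Monotone d)
    (hd' : Tendsto d atTop atTop) {F : lp E p → lp E p}
    {W Z : Set (lp E p)} {T l : ℝ} {u : ℕ → lp E p → ℝ → lp E p}
    (nonneg : 0 ≤ T) (isCompact : IsCompact W) (subset : Z ⊆ W)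
    (mapsTo : ∀ n, MapsTo (lpGalerkin E p (d n)) W W) (continuousOn : ContinuousOn F W)
    (oneSided : ∀ n, OneSidedLipschitzOnWith l (fun y => lpGalerkin E p (d n) (F y))
      (lpGalerkin E p (d n) '' W))
    (sol_continuousOn : ∀ n, ∀ x ∈ Z, ContinuousOn (u n x) (Icc 0 T))
    (sol_init : ∀ n, ∀ x ∈ Z, u n x 0 = lpGalerkin E p (d n) x)
    (sol_hasDerivAt : ∀ n, ∀ x ∈ Z, ∀ t ∈ Ioo 0 T,
      HasDerivAt (u n x) (lpGalerkin E p (d n) (F (u n x t))) t)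
    (sol_mem : ∀ n, ∀ x ∈ Z, ∀ t ∈ Icc 0 T, u n x t ∈ W)
    (sol_proj : ∀ n, ∀ x ∈ Z, ∀ t ∈ Icc 0 T, lpGalerkin E p (d n) (u n x t) = u n x t) :
    GalerkinConvergenceSetting (fun n => lpGalerkin E p (d n)) F W Z T l u where
  nonneg := nonneg
  isCompact := isCompact
  subset := subset
  opNorm_le := ⟨1, fun n => opNorm_lpGalerkin_le (d n)⟩
  tendsto_proj := fun w => (tendsto_lpGalerkin hp w).comp hd'
  proj_comp := fun _ _ hnk w => lpGalerkin_comp (hd hnk) w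
  mapsTo := mapsTo
  continuousOn := continuousOn
  oneSided := oneSided
  sol_continuousOn := sol_continuousOn
  sol_init := sol_init
  sol_hasDerivAt := sol_hasDerivAt
  sol_mem := sol_mem
  sol_proj := sol_proj

/-- Hence the `C⁰`-convergence theorem on `ℓᵖ(ℕ; E)` with complete fibres: the conclusions (1)–(3)
of `GalerkinConvergenceSetting.exists_limit`. [cite: WilczakZgliczynski2025, §4 Thm. 11 (1)–(3)] -/
theorem GalerkinConvergenceSetting.exists_limit_lp [∀ i, CompleteSpace (E i)]
    {F : lp E p → lp E p} {W Z : Set (lp E p)} {T l : ℝ} {u : ℕ → lp E p → ℝ → lp E p}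
    {d : ℕ → ℕ} (h : GalerkinConvergenceSetting (fun n => lpGalerkin E p (d n)) F W Z T l u) :
    ∃ φ : lp E p → ℝ → lp E p,
      TendstoUniformlyOn (fun n (q : lp E p × ℝ) => u n q.1 q.2) (fun q => φ q.1 q.2) atTop
        (Z ×ˢ Icc 0 T) ∧
      (∀ x ∈ Z, φ x 0 = x ∧ ContinuousOn (φ x) (Icc 0 T) ∧ (∀ t ∈ Icc 0 T, φ x t ∈ W) ∧
        ∀ t ∈ Ioo 0 T, HasDerivAt (φ x) (F (φ x t)) t) ∧
      (∀ x ∈ Z, ∀ w : ℝ → lp E p, ContinuousOn w (Icc 0 T) → w 0 = x →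
        (∀ t ∈ Ioo 0 T, HasDerivAt w (F (w t)) t) → (∀ t ∈ Icc 0 T, w t ∈ W) →
        ∀ t ∈ Icc 0 T, w t = φ x t) ∧
      (∀ x ∈ Z, ∀ y ∈ Z, ∀ t ∈ Icc 0 T, ‖φ x t - φ y t‖ ≤ Real.exp (l * t) * ‖x - y‖) :=
  h.exists_limit

end

end Literature.Analysis.ODE
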